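import Summits.Ventures.PackingBounds.Configurations.CL17Pairs
import Summits.Ventures.PackingBounds.Kissing.DimensionSeventeen

/-!
# Cohn–Li in dimension `17`, V: `κ(17) ≥ 5730` in Lean

Framing: lottery ticket; floor = certified bounds/negative ranges. Venture `PackingBounds` (cell
`pub-packcert`, seat `pub-packcert-energy`).

The five parts of `cl17Int ⊂ ℤ²⁴` (`CL17Count.lean`) are disjoint (they have `2, 8, 6, 0, 16` nonzero cells), so
`|cl17Int| = 480 + 3840 + 1024 + 2 + 384 = 5730`; every vector has norm `72` and distinct vectors have
`ip ≤ 36` (`CL17Pairs.lean`).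
They lie in the `17`-dimensional subspace `{y₁₆ = y₁₇, y₁₈ = ⋯ = y₂₃ = 0}` of `ℝ²⁴`; scaling by `1/√72` and
transferring (`Config.exists_transfer_orthogonal` with the `7` normals `e₁₆ − e₁₇, e₁₈, …, e₂₃`) gives
**a kissing configuration of `5730` unit vectors in `ℝ¹⁷`**: `κ(17) ≥ 5730` (Cohn–Li 2024, Theorem 1.1 — the
record lower bound in dimension `17` at the time of writing), here a kernel-checked theorem
(`exists_kissing_5730`); with the cell's Delsarte LP certificate, `5730 ≤ κ(17) ≤ 12218`.

## References
* H. Cohn, A. Li, *Improved kissing numbers in seventeen through twenty-one dimensions*, arXiv:2411.04916 (2024), Thm. 1.1, §3. [`CohnLi2024`]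
* J. H. Conway, N. J. A. Sloane, *Sphere Packings, Lattices and Groups*, Ch. 1 Table 1.2. [`ConwaySloane1999`]
-/

namespace Summit.Ventures.PackingBounds.Config.CL17

open Finset Leech Golay

/-! ### Disjointness by the number of nonzero cells, and the total -/

/-- Number of nonzero cells: shape `A` has `2`. -/
theorem nz_setA {x : Fin 24 → ℤ} (hx : x ∈ setA) : (cells.filter fun j => x j ≠ 0).card = 2 := by
  obtain ⟨k, l, a, b, ⟨hkl, hl⟩, rfl⟩ := mem_setA.mp hx
  rw [aV, card_nz_pvec (pair_sub (lt_trans hkl hl) hl) _ (by norm_num), Finset.card_pair (ne_of_lt hkl)]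

/-- Number of nonzero cells: shape `B` has `8`. -/
theorem nz_setB {x : Fin 24 → ℤ} (hx : x ∈ setB) : (cells.filter fun j => x j ≠ 0).card = 8 := by
  obtain ⟨i, v, _, rfl⟩ := mem_setB.mp hx
  rw [card_nz_pvec (supp_w8_sub i) _ (by norm_num), card_supp_w8]

/-- Number of nonzero cells: shape `X` has `6`. -/
theorem nz_setX {x : Fin 24 → ℤ} (hx : x ∈ setX) : (cells.filter fun j => x j ≠ 0).card = 6 := by
  obtain ⟨i, v, _, c, rfl⟩ := mem_setX.mp hx
  rw [card_nz_pvec (supp_x6_sub i) _ (by norm_num), card_supp_x6]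

/-- Number of nonzero cells: shape `T` has `0`. -/
theorem nz_setT {x : Fin 24 → ℤ} (hx : x ∈ setT) : (cells.filter fun j => x j ≠ 0).card = 0 := by
  obtain ⟨c, rfl⟩ := mem_setT.mp hx
  rw [Finset.card_eq_zero, Finset.filter_eq_empty_iff]
  intro j hj
  rw [pvec_apply_of_lt _ _ _ _ (mem_cells.mp hj)]
  simp

/-- Number of nonzero cells: shape `D` has `16`. -/
theorem nz_setD {x : Fin 24 → ℤ} (hx : x ∈ setD) : (cells.filter fun j => x j ≠ 0).card = 16 := by
  obtain ⟨p, _, m, _, rfl⟩ := mem_setD.mp hx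
  rw [card_nz_pvec subset_rfl _ (by norm_num), card_cells]

/-- Parts with different numbers of nonzero cells are disjoint. -/
theorem disjoint_of_nz {P Q : Finset (Fin 24 → ℤ)} {p q : ℕ} (hpq : p ≠ q)
    (hP : ∀ x ∈ P, (cells.filter fun j => x j ≠ 0).card = p)
    (hQ : ∀ x ∈ Q, (cells.filter fun j => x j ≠ 0).card = q) : Disjoint P Q := by
  rw [Finset.disjoint_left]
  intro x hxP hxQ
  exact hpq ((hP x hxP).symm.trans (hQ x hxQ))

/-- **`|cl17Int| = 480 + 3840 + 1024 + 2 + 384 = 5730`.** -/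
theorem card_cl17Int : cl17Int.card = 5730 := by
  have hAB : Disjoint setA setB := disjoint_of_nz (by norm_num) (fun x => nz_setA) (fun x => nz_setB)
  have h2 : Disjoint (setA ∪ setB) setX := by
    rw [disjoint_union_left]
    exact ⟨disjoint_of_nz (by norm_num) (fun x => nz_setA) (fun x => nz_setX),
      disjoint_of_nz (by norm_num) (fun x => nz_setB) (fun x => nz_setX)⟩
  have h3 : Disjoint (setA ∪ setB ∪ setX) setT := by
    rw [disjoint_union_left, disjoint_union_left]
    exact ⟨⟨disjoint_of_nz (by norm_num) (fun x => nz_setA) (fun x => nz_setT),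
      disjoint_of_nz (by norm_num) (fun x => nz_setB) (fun x => nz_setT)⟩,
      disjoint_of_nz (by norm_num) (fun x => nz_setX) (fun x => nz_setT)⟩
  have h4 : Disjoint (setA ∪ setB ∪ setX ∪ setT) setD := by
    rw [disjoint_union_left, disjoint_union_left, disjoint_union_left]
    exact ⟨⟨⟨disjoint_of_nz (by norm_num) (fun x => nz_setA) (fun x => nz_setD),
      disjoint_of_nz (by norm_num) (fun x => nz_setB) (fun x => nz_setD)⟩,
      disjoint_of_nz (by norm_num) (fun x => nz_setX) (fun x => nz_setD)⟩,
      disjoint_of_nz (by norm_num) (fun x => nz_setT) (fun x => nz_setD)⟩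
  rw [cl17Int, card_union_of_disjoint h4, card_union_of_disjoint h3, card_union_of_disjoint h2,
    card_union_of_disjoint hAB, card_setA, card_setB, card_setX, card_setT, card_setD]

/-! ### Norms -/

/-- Every vector of the configuration has norm `72`. -/
theorem ip_self_of_mem {x : Fin 24 → ℤ} (hx : x ∈ cl17Int) : ip x x = 72 := by
  rcases mem_cl17Int hx with hx | hx | hx | hx | hx
  · obtain ⟨k, l, a, b, ⟨hkl, hl⟩, rfl⟩ := mem_setA.mp hx
    rw [aV, ip_pvec_self (pair_sub (lt_trans hkl hl) hl), card_pair (ne_of_lt hkl)]; norm_num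
  · obtain ⟨i, v, _, rfl⟩ := mem_setB.mp hx
    rw [ip_pvec_self (supp_w8_sub i), card_supp_w8]; norm_num
  · obtain ⟨i, v, _, c, rfl⟩ := mem_setX.mp hx
    rw [ip_pvec_self (supp_x6_sub i), card_supp_x6]
    rcases sgn_cases c with h | h <;> rw [h] <;> norm_num
  · obtain ⟨c, rfl⟩ := mem_setT.mp hx
    rw [ip_pvec_self (Finset.empty_subset _), Finset.card_empty]
    rcases sgn_cases c with h | h <;> rw [h] <;> norm_num
  · obtain ⟨p, _, m, _, rfl⟩ := mem_setD.mp hx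
    rw [ip_pvec_self subset_rfl, card_cells]
    rcases sgn_cases (decide (6 ≤ p)) with h | h <;> rw [h] <;> norm_num

/-- Every vector of the configuration is a pattern vector on cells. -/
theorem exists_pvec_of_mem {x : Fin 24 → ℤ} (hx : x ∈ cl17Int) :
    ∃ S : Finset (Fin 24), ∃ f : Fin 24 → Bool, ∃ a e : ℤ, S ⊆ cells ∧ x = pvec S f a e := by
  rcases mem_cl17Int hx with hx | hx | hx | hx | hx
  · obtain ⟨k, l, a, b, ⟨hkl, hl⟩, rfl⟩ := mem_setA.mp hx
    exact ⟨_, _, _, _, pair_sub (lt_trans hkl hl) hl, rfl⟩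
  · obtain ⟨i, v, _, rfl⟩ := mem_setB.mp hx; exact ⟨_, _, _, _, supp_w8_sub i, rfl⟩
  · obtain ⟨i, v, _, c, rfl⟩ := mem_setX.mp hx; exact ⟨_, _, _, _, supp_x6_sub i, rfl⟩
  · obtain ⟨c, rfl⟩ := mem_setT.mp hx; exact ⟨_, _, _, _, Finset.empty_subset _, rfl⟩
  · obtain ⟨p, _, m, _, rfl⟩ := mem_setD.mp hx; exact ⟨_, _, _, _, subset_rfl, rfl⟩

/-- The two axis coordinates agree. -/
theorem apply_16_eq_17 {x : Fin 24 → ℤ} (hx : x ∈ cl17Int) : x 16 = x 17 := by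
  obtain ⟨S, f, a, e, hS, rfl⟩ := exists_pvec_of_mem hx
  exact pvec_apply_16_eq_17 hS f a e

/-- The configuration vanishes beyond coordinate `17`. -/
theorem apply_eq_zero_of_ge {x : Fin 24 → ℤ} (hx : x ∈ cl17Int) {j : Fin 24} (hj : 18 ≤ j.val) : x j = 0 := by
  obtain ⟨S, f, a, e, hS, rfl⟩ := exists_pvec_of_mem hx
  exact pvec_apply_ge hS f a e hj

/-! ### The configuration in `ℝ²⁴` and its transfer to `ℝ¹⁷` -/

/-- **The Cohn–Li `17`-dimensional kissing configuration**, normalised, inside `ℝ²⁴`.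
[cite: CohnLi2024, Thm. 1.1, §3] -/
noncomputable def cl17 : Finset (EuclideanSpace ℝ (Fin 24)) := cl17Int.image (toE 72)

/-- `|cl17| = 5730`. -/
theorem card_cl17 : cl17.card = 5730 := by
  rw [cl17, card_image_of_injective _ (toE_injective (by norm_num)), card_cl17Int]

/-- Unit vectors. -/
theorem norm_cl17 : ∀ p ∈ cl17, ‖p‖ = 1 := by
  intro p hp
  obtain ⟨x, hx, rfl⟩ := mem_image.mp hp
  exact norm_toE (by norm_num) (by rw [ip_self_of_mem hx]; norm_num)

/-- Pairwise inner products `≤ 1/2`. -/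
theorem inner_cl17 : ∀ a ∈ cl17, ∀ b ∈ cl17, a ≠ b → inner ℝ a b ≤ 1 / 2 := by
  intro a ha b hb hab
  obtain ⟨x, hx, rfl⟩ := mem_image.mp ha
  obtain ⟨y, hy, rfl⟩ := mem_image.mp hb
  have hxy : x ≠ y := fun h => hab (by rw [h])
  rw [inner_toE (by norm_num), div_le_iff₀ (by norm_num)]
  have h : (ip x y : ℝ) ≤ 36 := by exact_mod_cast ip_le_of_mem hx hy hxy
  linarith

/-- The `7` normals cutting out the `17`-dimensional subspace `{y₁₆ = y₁₇, y₁₈ = ⋯ = y₂₃ = 0}` of `ℝ²⁴`. -/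
noncomputable def nrm (i : Fin 7) : EuclideanSpace ℝ (Fin 24) :=
  if i.val = 0 then EuclideanSpace.single ⟨16, by norm_num⟩ 1 - EuclideanSpace.single ⟨17, by norm_num⟩ 1
  else EuclideanSpace.single ⟨17 + i.val, by omega⟩ 1

/-- The configuration is orthogonal to the normals. -/
theorem inner_nrm_cl17 (i : Fin 7) : ∀ p ∈ cl17, inner ℝ (nrm i) p = 0 := by
  intro p hp
  obtain ⟨x, hx, rfl⟩ := mem_image.mp hp
  unfold nrm
  split_ifs with hi
  · rw [inner_sub_left, EuclideanSpace.inner_single_left, EuclideanSpace.inner_single_left, map_one, one_mul,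
      one_mul, toE_apply, toE_apply]
    have h : x ⟨16, by norm_num⟩ = x ⟨17, by norm_num⟩ := apply_16_eq_17 hx
    rw [h, sub_self]
  · rw [EuclideanSpace.inner_single_left, map_one, one_mul, toE_apply,
      apply_eq_zero_of_ge hx (j := ⟨17 + i.val, by omega⟩) (show 18 ≤ 17 + i.val by omega)]
    simp

/-- The normals are linearly independent (pairwise orthogonal and nonzero). -/
theorem linearIndependent_nrm : LinearIndependent ℝ nrm := by
  have ho := orthonormal_iff_ite.mp (EuclideanSpace.orthonormal_single (𝕜 := ℝ) (ι := Fin 24))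
  apply linearIndependent_of_ne_zero_of_inner_eq_zero
  · intro i h
    by_cases hi : i.val = 0
    · have h16 := congrArg (fun v : EuclideanSpace ℝ (Fin 24) => v ⟨16, by norm_num⟩) h
      simp [nrm, hi] at h16
    · have hj := congrArg (fun v : EuclideanSpace ℝ (Fin 24) => v ⟨17 + i.val, by omega⟩) h
      simp [nrm, hi] at hj
  · intro i j hij
    have hval : i.val ≠ j.val := fun h => hij (Fin.ext h)
    unfold nrm
    by_cases hi : i.val = 0 <;> by_cases hj : j.val = 0
    · exact absurd (hi.trans hj.symm) hval
    · rw [if_pos hi, if_neg hj, inner_sub_left, ho, ho, if_neg (fun h => by have := Fin.mk.inj_iff.mp h; omega),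
        if_neg (fun h => by have := Fin.mk.inj_iff.mp h; omega), sub_zero]
    · rw [if_neg hi, if_pos hj, inner_sub_right, ho, ho, if_neg (fun h => by have := Fin.mk.inj_iff.mp h; omega),
        if_neg (fun h => by have := Fin.mk.inj_iff.mp h; omega), sub_zero]
    · rw [if_neg hi, if_neg hj, ho, if_neg (fun h => hval (by have := Fin.mk.inj_iff.mp h; omega))]

/-! ### The theorems -/

/-- **`κ(17) ≥ 5730`** (Cohn–Li 2024, Theorem 1.1): a kissing configuration of `5730` unit vectors in `ℝ¹⁷`. -/
theorem exists_kissing_5730 : ∃ C : Finset (EuclideanSpace ℝ (Fin 17)),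
    C.card = 5730 ∧ (∀ x ∈ C, ‖x‖ = 1) ∧ (∀ x ∈ C, ∀ y ∈ C, x ≠ y → inner ℝ x y ≤ 1 / 2) := by
  obtain ⟨C', hc, hno, hi, _⟩ := exists_transfer_orthogonal (m := 24) (n := 17) (k := 7) (by norm_num)
    nrm linearIndependent_nrm cl17 (fun x hx i => inner_nrm_cl17 i x hx)
  refine ⟨C', by rw [hc, card_cl17], fun x' hx' => ?_, fun x' hx' y' hy' hne => ?_⟩
  · obtain ⟨x, hx, he⟩ := hno x' hx'
    rw [he]; exact norm_cl17 x hx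
  · obtain ⟨x, hx, y, hy, hxy, he⟩ := hi x' hx' y' hy' hne
    rw [he]; exact inner_cl17 x hx y hy hxy

/-- **`5730 ≤ κ(17) ≤ 12218` in Lean** (explicit Cohn–Li configuration; Delsarte LP certificate of the cell). -/
theorem kissing_dim17_bracket :
    (∃ C : Finset (EuclideanSpace ℝ (Fin 17)), C.card = 5730 ∧ (∀ x ∈ C, ‖x‖ = 1) ∧
      (∀ x ∈ C, ∀ y ∈ C, x ≠ y → inner ℝ x y ≤ 1 / 2)) ∧
    ∀ C : Finset (EuclideanSpace ℝ (Fin 17)), (∀ x ∈ C, ‖x‖ = 1) →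
      (∀ x ∈ C, ∀ y ∈ C, x ≠ y → inner ℝ x y ≤ 1 / 2) → C.card ≤ 12218 :=
  ⟨exists_kissing_5730, Kissing.kissing_dim17_le_12218⟩

end Summit.Ventures.PackingBounds.Config.CL17
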